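import Summits.FinalStateConjecture.FinalStateConjecture.Cruxes.TameExitsLocalise.Ideator1Sketch
import Summits.FinalStateConjecture.FinalStateConjecture.Cruxes.TameExitsLocalise.IdeatorK2Sketch

/-!
# Crux-triage r1 / panelist 3 — kernel-checked certificates for crux B `TameExitsLocalise`
(stmt-FinalStateConjecture-16894)

Part A (`causal-quarantine` / `charge-ballast-gluing`, ideator 1's typed objects):
* `coreSourced_not_good` — sanity of the vocabulary: a core-sourced admissible datum is exceptional
  (so the missing `¬ Good d⋆` hypothesis of `QuarantinedRobustness` is implied).
* `CoreClass` — the crux RESTRICTED to tail-smooth, core-sourced base data (the lever's whole reach);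
  `coreClass_of_cards : SlavedTailGluing → QuarantinedRobustness → CoreClass`.
* `tameExitsLocalise_iff_core_and_residual : TameExitsLocalise ↔ CoreClass ∧ ResidualClass` and
  `residualClass_of_tameExitsLocalise` — the third leg `ResidualClass` of the card's composition is the crux
  verbatim on the complementary class (definitional split, no content).
* `residualClass_false_of_offClassWitness` — the landed negation frame (p165912) bites the residual leg
  verbatim as soon as the incurable tamely-curable witness is off-class (not tail-smooth or not core-sourced
  on the exit's end), which is the census datum `d_GO` by design (two controlled derivatives only).

Part B (`core-tail-rectangle` / `badness-transfers`, ideator 2's typed kits; independent reproduction of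
panelist 2's costume certificate): `RectangleBit d⋆ F ↔ LocalExitWindow d⋆` and
`NakedTransferAt d⋆ F ↔ LocalExitWindow d⋆` at an admissible good punctured exit, hence
`RectangleBitAtExits ↔ TameExitsLocalise` and `NakedTransferAtExits ↔ TameExitsLocalise`.
-/

noncomputable section

set_option linter.dupNamespace false

namespace Summit.FinalStateConjecture.FinalStateConjecture.Cruxes.TameExitsLocalise.Triage3

open scoped Manifold ContDiff Topology
open Literature.Geometry.Lorentzian
open Summit.FinalStateConjecture.FinalStateConjecture.Theses.LaminatedThreshold

/-! ## Part A — ideator 1 (`causal-quarantine`, `charge-ballast-gluing`) -/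

section PartA

open Summit.FinalStateConjecture.FinalStateConjecture.Cruxes.TameExitsLocalise.Ideator1

variable {X : Type} [TopologicalSpace X] [ChartedSpace E3 X] [IsManifold (𝓡 3) ∞ X] [T2Space X]
  [SecondCountableTopology X] [ConnectedSpace X]

omit [T2Space X] [SecondCountableTopology X] in
/-- A core-sourced admissible datum is exceptional: take `d' = d⋆`, `U = univ`. -/
theorem coreSourced_not_good {e : AFEnd X} {dstar : InitialDataSet (𝓡 3) X}
    (hd : dstar ∈ admissibleVacuumData X) (hcs : CoreSourced e dstar) : ¬ Good dstar := by
  obtain ⟨L, -, μ, hμ, h⟩ := hcs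
  exact h dstar hd ⟨Set.univ, isOpen_univ, Set.subset_univ L, fun x _ ↦ ⟨rfl, rfl⟩⟩
    (fun r _ ↦ by linarith)

end PartA

section PartA'

open Summit.FinalStateConjecture.FinalStateConjecture.Cruxes.TameExitsLocalise.Ideator1

/-- The crux RESTRICTED to tail-smooth, core-sourced base data on the exit's end — the entire reach of the
quarantine lever (same shape as `ResidualClass` with the class hypothesis un-negated). -/
def CoreClass : Prop :=
  ∀ (X : Type) [TopologicalSpace X] [ChartedSpace E3 X] [IsManifold (𝓡 3) ∞ X] [T2Space X]
    [SecondCountableTopology X] [ConnectedSpace X] (e : AFEnd X) (dstar : InitialDataSet (𝓡 3) X)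
    (F : EuclideanSpace ℝ (Fin 1) → InitialDataSet (𝓡 3) X),
    dstar ∈ admissibleVacuumData X → ¬ Good dstar → (TailSmooth e dstar ∧ CoreSourced e dstar) →
    InitialDataSet.IsTameDataFamily e 1 F → InitialDataSet.IsImmersedAtZero 1 F → F 0 = dstar →
    Function.Injective F → (∀ c, F c ∈ admissibleVacuumData X) → (∀ c, c ≠ 0 → Good (F c)) →
    ∃ F' : EuclideanSpace ℝ (Fin 1) → InitialDataSet (𝓡 3) X,
      InitialDataSet.IsSmoothDataFamily 1 F' ∧ InitialDataSet.IsImmersedAtZero 1 F' ∧ F' 0 = dstar ∧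
      Function.Injective F' ∧ (∀ c, F' c ∈ admissibleVacuumData X) ∧
      (∃ C : Set X, IsCompact C ∧
        ∀ c, ∀ x ∉ C, (F' c).h.inner x = dstar.h.inner x ∧ (F' c).k x = dstar.k x) ∧
      ∃ ε : ℝ, 0 < ε ∧ ∀ c, c ≠ 0 → ‖c‖ < ε → Good (F' c)

/-- The two card stubs give exactly the crux on the lever's class (the card's composition minus its
residual leg). -/
theorem coreClass_of_cards (hglue : SlavedTailGluing) (hrob : QuarantinedRobustness) : CoreClass := by
  intro X _ _ _ _ _ _ e dstar F hD hbad hcls hF himm h0 hinj hadm hgood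
  obtain ⟨Rstar, hR⟩ := hrob X e dstar F hD hcls.1 hcls.2 hF h0 hadm hgood
  obtain ⟨R₁, hR₁, F', σ, ε₁, hF', himm', h0', hinj', hadm', hC', hσc, hσ0, hσne, hε₁, hcore⟩ :=
    hglue X e dstar F hD hbad hF himm h0 hinj hadm Rstar
  obtain ⟨ε, hε, hwin⟩ := hR R₁ hR₁ F' σ hF' h0' hadm' hC' hσc hσ0 hσne ⟨ε₁, hε₁, hcore⟩
  exact ⟨F', hF', himm', h0', hinj', hadm', hC', ε, hε, hwin⟩

/-- The residual leg is implied by the crux (it IS the crux with two extra hypotheses). -/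
theorem residualClass_of_tameExitsLocalise (hB : TameExitsLocalise) : ResidualClass := by
  intro X _ _ _ _ _ _ e dstar F hD hbad _ hF himm h0 hinj hadm hgood
  exact hB X dstar hD hbad ⟨e, F, hF, himm, h0, hinj, hadm, hgood⟩

/-- The crux on the lever's class is implied by the crux. -/
theorem coreClass_of_tameExitsLocalise (hB : TameExitsLocalise) : CoreClass := by
  intro X _ _ _ _ _ _ e dstar F hD hbad _ hF himm h0 hinj hadm hgood
  exact hB X dstar hD hbad ⟨e, F, hF, himm, h0, hinj, hadm, hgood⟩

/-- **Definitional split.** The crux is EQUIVALENT to (crux on the lever's class) ∧ (the card's residual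
leg): the residual is not a remainder term but the crux itself on the complementary class. -/
theorem tameExitsLocalise_iff_core_and_residual : TameExitsLocalise ↔ CoreClass ∧ ResidualClass := by
  refine ⟨fun hB ↦ ⟨coreClass_of_tameExitsLocalise hB, residualClass_of_tameExitsLocalise hB⟩,
    fun ⟨hcore, hres⟩ ↦ ?_⟩
  intro X _ _ _ _ _ _ dstar hD hbad hexit
  obtain ⟨e, F, hF, himm, h0, hinj, hadm, hgood⟩ := hexit
  by_cases hcls : TailSmooth e dstar ∧ CoreSourced e dstar
  · exact hcore X e dstar F hD hbad hcls hF himm h0 hinj hadm hgood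
  · exact hres X e dstar F hD hbad hcls hF himm h0 hinj hadm hgood

/-- **Off-class incurable tamely-curable witness** — the landed construction target
`Theorems.TameExitsLocalise.Negative.ExistsIncurableTameExit` (p165912) with ONE extra conjunct: the exit's
end `e` does not see the base datum as tail-smooth-and-core-sourced. The census witness `d_GO` is designed
with exactly two controlled derivatives of `h` at infinity (high-frequency shell train), i.e. NOT
`TailSmooth` on its sole end, so it is off-class. -/
def ExistsOffClassIncurableTameExit : Prop :=
  ∃ (X : Type) (_ : TopologicalSpace X) (_ : ChartedSpace E3 X) (_ : IsManifold (𝓡 3) ∞ X) (_ : T2Space X)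
    (_ : SecondCountableTopology X) (_ : ConnectedSpace X) (dstar : InitialDataSet (𝓡 3) X)
    (e : AFEnd X) (F : EuclideanSpace ℝ (Fin 1) → InitialDataSet (𝓡 3) X),
    dstar ∈ admissibleVacuumData X ∧
    (∀ C : Set X, IsCompact C → ∀ d' ∈ admissibleVacuumData X,
      (∀ x ∉ C, d'.h.inner x = dstar.h.inner x ∧ d'.k x = dstar.k x) → ¬ Good d') ∧
    ¬ (TailSmooth e dstar ∧ CoreSourced e dstar) ∧
    InitialDataSet.IsTameDataFamily e 1 F ∧ InitialDataSet.IsImmersedAtZero 1 F ∧ F 0 = dstar ∧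
    Function.Injective F ∧ (∀ c, F c ∈ admissibleVacuumData X) ∧ ∀ c, c ≠ 0 → Good (F c)

/-- **The residual leg inherits the crux's negation witness.** Same ten lines as
`tameExitsLocalise_false_of_existsIncurableTameExit`: at an off-class, locally incurable datum with a tame good
exit, `ResidualClass` yields a compactly supported family whose member at `c = (ε/2)·e₀` is both good (window)
and exceptional (incurability). So `ResidualClass` is false modulo exactly what makes the crux false. -/
theorem residualClass_false_of_offClassWitness (h : ExistsOffClassIncurableTameExit) : ¬ ResidualClass := by
  obtain ⟨X, i₁, i₂, i₃, i₄, i₅, i₆, dstar, e, F, hd, hinc, hoff, hF, himm, h0, hinj, hadm, hgood⟩ := h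
  intro hres
  have hbad : ¬ Good dstar := hinc ∅ isCompact_empty dstar hd fun _ _ ↦ ⟨rfl, rfl⟩
  obtain ⟨F', -, -, -, -, hadm', ⟨C, hC, hagree⟩, ε, hε, hwin⟩ :=
    hres X e dstar F hd hbad hoff hF himm h0 hinj hadm hgood
  set v : EuclideanSpace ℝ (Fin 1) := EuclideanSpace.single (0 : Fin 1) (1 : ℝ) with hv
  have hnv : ‖v‖ = 1 := by simp [hv]
  set c : EuclideanSpace ℝ (Fin 1) := (ε / 2) • v with hc
  have hnorm : ‖c‖ = ε / 2 := by
    rw [hc, norm_smul, hnv, mul_one, Real.norm_eq_abs, abs_of_pos (by positivity)]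
  have hc0 : c ≠ 0 := by
    intro h0'
    rw [h0', norm_zero] at hnorm
    linarith
  have hcε : ‖c‖ < ε := by rw [hnorm]; linarith
  exact hinc C hC (F' c) (hadm' c) (hagree c) (hwin c hc0 hcε)

end PartA'

/-! ## Part B — ideator 2 (`core-tail-rectangle`, `badness-transfers`): the typed kits are the crux -/

section PartB

open Summit.FinalStateConjecture.FinalStateConjecture.Cruxes.TameExitsLocalise.IdeatorK2

variable {X : Type} [TopologicalSpace X] [ChartedSpace E3 X] [IsManifold (𝓡 3) ∞ X] [T2Space X]
  [SecondCountableTopology X] [ConnectedSpace X]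

omit [T2Space X] [SecondCountableTopology X] in
/-- Any local exit window is a rectangle-with-bit: `H a b := F' a` on the column `b = 0`, `F b` elsewhere,
`P = Q = ⊤`. So `RectangleBit` carries no superposition content at the typed level. -/
theorem rectangleBit_of_localExitWindow {dstar : InitialDataSet (𝓡 3) X}
    {F : P1 → InitialDataSet (𝓡 3) X} (h0 : F 0 = dstar) (hadmF : ∀ c, F c ∈ admissibleVacuumData X)
    (hgood : ∀ c, c ≠ 0 → Good (F c)) (hW : LocalExitWindow dstar) : RectangleBit dstar F := by
  classical
  obtain ⟨F', hsm, himm, h0', hinj, hadm', ⟨C, hC, hoff⟩, ε, hε, hwin⟩ := hW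
  let H : P1 → P1 → InitialDataSet (𝓡 3) X := fun a b ↦ if b = 0 then F' a else F b
  have hcol : (fun a ↦ H a 0) = F' := funext fun a ↦ if_pos rfl
  refine ⟨C, H, fun _ ↦ True, fun _ ↦ True, ε, hC, hε, ?_, ?_, ?_, ?_, ?_, ?_, ?_, trivial⟩
  · intro c
    by_cases hc : c = 0
    · simp only [H, if_pos hc]; rw [hc, h0', h0]
    · simp only [H, if_neg hc]
  · intro a b
    by_cases hb : b = 0
    · simp only [H, if_pos hb]; exact hadm' a
    · simp only [H, if_neg hb]; exact hadmF b
  · intro a b x hx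
    by_cases hb : b = 0
    · simp only [H, if_pos hb]; rw [hb, h0]; exact hoff a x hx
    · simp only [H, if_neg hb, and_self]
  · rw [hcol]; exact hsm
  · rw [hcol]; exact himm
  · rw [hcol]; exact hinj
  · intro a b ha haε _
    simp only [and_self, iff_true]
    by_cases hb : b = 0
    · simp only [H, if_pos hb]; exact hwin a ha haε
    · simp only [H, if_neg hb]; exact hgood b hb

/-- `RectangleBit d⋆ F ↔ LocalExitWindow d⋆` at an admissible good punctured exit through `d⋆`. -/
theorem rectangleBit_iff_localExitWindow {dstar : InitialDataSet (𝓡 3) X}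
    {F : P1 → InitialDataSet (𝓡 3) X} (h0 : F 0 = dstar) (hadmF : ∀ c, F c ∈ admissibleVacuumData X)
    (hgood : ∀ c, c ≠ 0 → Good (F c)) : RectangleBit dstar F ↔ LocalExitWindow dstar :=
  ⟨localExitWindow_of_rectangleBit h0 hgood, rectangleBit_of_localExitWindow h0 hadmF hgood⟩

omit [T2Space X] [SecondCountableTopology X] in
/-- Any local exit window is a naked-transfer kit: `L := F'`, `S := ∅`, `Naked := ⊥` (NT, NL vacuous; CB =
the window). So `NakedTransferAt` carries no locality / sojourn content at the typed level. -/
theorem nakedTransferAt_of_localExitWindow {dstar : InitialDataSet (𝓡 3) X}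
    (F : P1 → InitialDataSet (𝓡 3) X) (hW : LocalExitWindow dstar) : NakedTransferAt dstar F := by
  obtain ⟨F', hsm, himm, h0', hinj, hadm', ⟨C, hC, hoff⟩, ε, hε, hwin⟩ := hW
  refine ⟨F', C, ∅, fun _ ↦ False, ε, hC, hε, hsm, himm, hinj, h0', hadm', hoff, ?_, ?_, ?_, ?_⟩
  · intro c x hx; exact absurd hx (Set.notMem_empty x)
  · intro d₁ _ d₂ _ _ h; exact h
  · intro d _ h; exact h.elim
  · intro c hc hcε hbad; exact hbad (hwin c hc hcε)

omit [T2Space X] [SecondCountableTopology X] in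
/-- `NakedTransferAt d⋆ F ↔ LocalExitWindow d⋆` at an admissible good punctured exit. -/
theorem nakedTransferAt_iff_localExitWindow {dstar : InitialDataSet (𝓡 3) X}
    {F : P1 → InitialDataSet (𝓡 3) X} (hadmF : ∀ c, F c ∈ admissibleVacuumData X)
    (hgood : ∀ c, c ≠ 0 → Good (F c)) : NakedTransferAt dstar F ↔ LocalExitWindow dstar :=
  ⟨localExitWindow_of_nakedTransfer hadmF hgood, nakedTransferAt_of_localExitWindow F⟩

end PartB

section PartB'

open Summit.FinalStateConjecture.FinalStateConjecture.Cruxes.TameExitsLocalise.IdeatorK2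

/-- The bundled stub of `core-tail-rectangle` IS the crux. -/
theorem rectangleBitAtExits_iff_tameExitsLocalise : RectangleBitAtExits ↔ TameExitsLocalise := by
  refine ⟨tameExitsLocalise_of_rectangleBit, fun hB ↦ ?_⟩
  intro X _ _ _ _ _ _ dstar hd hbad e F hF himm h0 hinj hadm hgood
  exact rectangleBit_of_localExitWindow h0 hadm hgood (hB X dstar hd hbad ⟨e, F, hF, himm, h0, hinj, hadm, hgood⟩)

/-- The bundled stub of `badness-transfers` IS the crux. -/
theorem nakedTransferAtExits_iff_tameExitsLocalise : NakedTransferAtExits ↔ TameExitsLocalise := by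
  refine ⟨tameExitsLocalise_of_nakedTransfer, fun hB ↦ ?_⟩
  intro X _ _ _ _ _ _ dstar hd hbad e F hF himm h0 hinj hadm hgood
  exact nakedTransferAt_of_localExitWindow F (hB X dstar hd hbad ⟨e, F, hF, himm, h0, hinj, hadm, hgood⟩)

end PartB'

end Summit.FinalStateConjecture.FinalStateConjecture.Cruxes.TameExitsLocalise.Triage3

end
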